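import Mathlib
import Literature.MathematicalPhysics.KineticTheory.InfiniteChainDynamics

/-!
# Sketch — crux-ideate stmt-AtomisticToContinuum-12593 (DrudeDissolution), round 1, ideator 3

First lemmas of the two idea cards filed by this seat (they must ELABORATE; they need not be proved):

* §1 `FreeEdgeAnchor` (card `kinetic-fixed-point-spectral-rg`): the ε = 0 anchor of the
  frequency-shell renormalisation — transversally to the resonance surface the free squared
  Liouvillian is multiplication by `(x · a(y))²`, and the Stieltjes transform of `|ψ|²` at `−s` has
  the ONE-DIMENSIONAL VAN HOVE EDGE `√s · S(s) → π ∫ |ψ(0,y)|² / |a(y)| dy` (Fubini normal form of the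
  co-area statement "edge coefficient = on-shell mass / |∇Ω| = Fermi-golden-rule form").
  `AbelOfSymmetricDerivative`: the Abelian half of the Hardy–Littlewood–Karamata equivalence used by
  the card (symmetric differentiability of the current spectral measure at 0 already gives the Abel
  limit that `closes` consumes) — provable now.
* §2 `NoOddRangeOneLaw` (card `integrability-test-no-local-odd-charge`): the pinned doubly-quartic
  chain has no local conservation law in the current's own class (p-linear, range one, cubic in q)
  once `lam, β > 0` — the algebraic certificate that Mazur's local atom is absent at every positive
  anharmonicity (kit j012623: kernel dimension 0 at generic parameters; = 1, the current, at
  `lam = β = 0`, Disproof §4 `hasDerivAt_bondCurrentZ_harmonic`).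
-/

noncomputable section

namespace Summit.AtomisticToContinuum.FouriersLaw.Cruxes.DrudeDissolution.IdeaSketch3

open MeasureTheory Filter Topology Set
open Literature.MathematicalPhysics.KineticTheory.HeatConduction

/-! ## §1 Card `kinetic-fixed-point-spectral-rg` -/

/-- FREE EDGE ANCHOR (Fubini normal form). For a finite measure space `(Y, μ)` (the resonance
surface `{Ω = 0}` with its surface measure), a transversal speed `a : Y → ℝ` bounded away from `0`
and `∞` (`= |∇Ω|` off the co-moving strata) and a jointly measurable, x-continuous, bounded,
compactly-x-supported
amplitude `ψ` (the bracket/force vector `K f` in normal coordinates), the Stieltjes transform of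
`|ψ|²` for the multiplication operator `(x a(y))²` at spectral parameter `−s` satisfies
`√s ∫∫ |ψ|²/((x a)² + s) → π ∫ |ψ(0,·)|²/|a|` as `s ↓ 0`: a one-dimensional van Hove edge whose
coefficient is the on-shell mass — the Fermi-golden-rule / linearised-Boltzmann form at `ε = 0`. -/
def FreeEdgeAnchor : Prop :=
  ∀ (Y : Type) [MeasurableSpace Y] (μ : Measure Y) [IsFiniteMeasure μ] (a : Y → ℝ) (ψ : ℝ → Y → ℝ),
    Measurable a → (∃ c : ℝ, 0 < c ∧ ∀ y, c ≤ |a y|) → (∃ C : ℝ, ∀ y, |a y| ≤ C) →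
    (∀ y, Continuous fun x => ψ x y) → Measurable (Function.uncurry ψ) →
    (∃ C : ℝ, ∀ x y, |ψ x y| ≤ C) →
    (∃ R : ℝ, ∀ x y, R < |x| → ψ x y = 0) →
    Tendsto (fun s : ℝ => Real.sqrt s * ∫ y, (∫ x, (ψ x y) ^ 2 / ((x * a y) ^ 2 + s)) ∂μ)
      (𝓝[>] (0 : ℝ)) (𝓝 (Real.pi * ∫ y, (ψ 0 y) ^ 2 / |a y| ∂μ))

/-- ABELIAN HALF OF HARDY–LITTLEWOOD–KARAMATA (what `closes` really consumes). If `σ` is a finite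
measure on `ℝ`, `C(t) = ∫ cos(ωt) dσ(ω)`, and the symmetric averages `σ(−ω, ω)/(2ω)` converge to
`g₀` as `ω ↓ 0`, then the Abel means converge: `∫_{t>0} e^{−νt} C(t) dt → π g₀` as `ν ↓ 0`
(integration by parts of `∫ ν/(ν²+ω²) dσ` against `ω ↦ σ(−ω,ω)`; the Poisson kernel's derivative has
mass `π`). Window CONTINUITY of a density is not needed for the route's deciding theorem; by the
Tauberian half (Karamata, positivity of `σ`) the converse also holds, so Abel convergence is
EQUIVALENT to symmetric differentiability of `σ` at `0`. Provable now. -/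
def AbelOfSymmetricDerivative : Prop :=
  ∀ (σ : Measure ℝ) (C : ℝ → ℝ) (g₀ : ℝ), IsFiniteMeasure σ →
    (∀ t : ℝ, C t = ∫ ω, Real.cos (ω * t) ∂σ) →
    Tendsto (fun ω : ℝ => σ.real (Ioo (-ω) ω) / (2 * ω)) (𝓝[>] (0 : ℝ)) (𝓝 g₀) →
    Tendsto (fun ν : ℝ => ∫ t in Ioi (0 : ℝ), Real.exp (-(ν * t)) * C t) (𝓝[>] (0 : ℝ))
      (𝓝 (Real.pi * g₀))

/-- EXACT DECIMATION STEP (finite-dimensional shadow, the algebra the RG iterates): for a positive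
semi-definite real symmetric block matrix `M = [[A, B], [Bᵀ, D]]` and `s > 0`, the compression of
`(M + s)⁻¹` to the first block is the inverse of the Schur complement
`A + s − B (D + s)⁻¹ Bᵀ`, which is again positive semi-definite plus `s` — so "integrate out the
fast block" is an exact, positivity-preserving map on effective operators at every scale, and it
composes (Schur of Schur = Schur). Mathlib has the block-inverse formulas
(`Matrix.fromBlocks`); stated here as the invariant the line uses. -/
def SchurDecimation : Prop :=
  ∀ (m n : ℕ) (A : Matrix (Fin m) (Fin m) ℝ) (B : Matrix (Fin m) (Fin n) ℝ)
    (D : Matrix (Fin n) (Fin n) ℝ) (s : ℝ), 0 < s →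
    (Matrix.fromBlocks A B B.transpose D).PosSemidef →
    ((Matrix.fromBlocks A B B.transpose D + s • (1 : Matrix (Fin m ⊕ Fin n) (Fin m ⊕ Fin n) ℝ))⁻¹).toBlocks₁₁
        = (A + s • (1 : Matrix (Fin m) (Fin m) ℝ)
            - B * (D + s • (1 : Matrix (Fin n) (Fin n) ℝ))⁻¹ * B.transpose)⁻¹ ∧
      (A - B * (D + s • (1 : Matrix (Fin n) (Fin n) ℝ))⁻¹ * B.transpose).PosSemidef

/-! ## §2 Card `integrability-test-no-local-odd-charge` -/

/-- The `k`-site window of a chain configuration starting at site `x`: `i ↦ σ (x + i)`. -/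
def windowAt (k : ℕ) (σ : ChainConfig) (x : ℤ) : Fin k → ℝ × ℝ := fun i => σ (x + i)

/-- The coordinates of a `k`-site window flattened to `Fin (2k)` real numbers
(`2i ↦ q`, `2i+1 ↦ p`), so that local polynomial fluxes are `MvPolynomial (Fin (2k)) ℝ`. -/
def windowCoords (k : ℕ) (w : Fin k → ℝ × ℝ) : Fin (2 * k) → ℝ :=
  fun j => if j.val % 2 = 0 then (w ⟨j.val / 2, by omega⟩).1 else (w ⟨j.val / 2, by omega⟩).2

/-- NO ODD LOCAL CONSERVATION LAW OF RANGE ONE (the current's own class). For the pinned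
doubly-quartic chain with `lam > 0` and `β > 0`: if a density `ρ_x = p_x · g(q_{x−1}, q_x, q_{x+1})`,
`g` a real polynomial of total degree `≤ 3` in three variables, obeys a LOCAL CONSERVATION LAW
`d/dt ρ_x = Φ_{x−1} − Φ_x` along every solution of the infinite chain, for some local polynomial flux
`Φ_x = Φ(q,p on the k sites x+o, …, x+o+k−1)` (any range `k`, any offset `o`), then `g = 0`. At `lam = β = 0` this is false: `g = −(X₂ − X₀)/2`
(the bond current, up to the symmetric split) is conserved (Disproof §4,
`hasDerivAt_bondCurrentZ_harmonic`). Certified generically by kit j012623 (kernel of the linear map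
`ρ ↦ δ{ρ,H}/δ(q₀,p₀)` on all odd ansätze of range ≤ 5: dimension 0 for `lam β ≠ 0`, also for
`lam = 0 < β` and `β = 0 < lam`; dimension = range at the harmonic point; = 1 (momentum) for the
unpinned FPU-β chain). Finite real linear algebra with `ω₂, lam, β` as parameters + existence of
finite-energy global solutions through every compactly supported datum; size M. -/
def NoOddRangeOneLaw : Prop :=
  ∀ ω₂ lam β γ : ℝ, 0 < ω₂ → 0 < lam → 0 < β →
    ∀ (g : MvPolynomial (Fin 3) ℝ), g.totalDegree ≤ 3 →
    ∀ (k : ℕ) (o : ℤ) (Φ : MvPolynomial (Fin (2 * k)) ℝ),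
    (∀ c : ℝ → ChainConfig, (pinnedChain ω₂ lam β γ).IsSolution c → ∀ (x : ℤ) (t : ℝ),
      HasDerivAt
        (fun s => (c s x).2 * MvPolynomial.eval (fun i : Fin 3 => (c s (x - 1 + i)).1) g)
        (MvPolynomial.eval (windowCoords k (windowAt k (c t) (x - 1 + o))) Φ -
          MvPolynomial.eval (windowCoords k (windowAt k (c t) (x + o))) Φ) t) →
    g = 0

/-- The same statement at the harmonic point is FALSE (sanity anchor for the prover: the bond
current is a range-one p-linear conserved density of the pinned harmonic chain), recorded as the
negation to be proved alongside. -/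
def HarmonicOddRangeOneLaw : Prop :=
  ∀ ω₂ γ : ℝ, 0 < ω₂ →
    ∃ (g : MvPolynomial (Fin 3) ℝ), g.totalDegree ≤ 3 ∧ g ≠ 0 ∧
    ∃ (k : ℕ) (o : ℤ) (Φ : MvPolynomial (Fin (2 * k)) ℝ),
    ∀ c : ℝ → ChainConfig, (pinnedChain ω₂ 0 0 γ).IsSolution c → ∀ (x : ℤ) (t : ℝ),
      HasDerivAt
        (fun s => (c s x).2 * MvPolynomial.eval (fun i : Fin 3 => (c s (x - 1 + i)).1) g)
        (MvPolynomial.eval (windowCoords k (windowAt k (c t) (x - 1 + o))) Φ -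
          MvPolynomial.eval (windowCoords k (windowAt k (c t) (x + o))) Φ) t

end Summit.AtomisticToContinuum.FouriersLaw.Cruxes.DrudeDissolution.IdeaSketch3

end
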